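import Summits.BirchSwinnertonDyer.BirchSwinnertonDyer.Theorems.SignedLowerHalvesSprungLowerDivisibilityAtThreeChromaticPerPairLevelOne
import Literature.NumberTheory.EllipticCurves.IwasawaAlgebraDivisibilityProofs
import HarnessLib

/-!
# Crux `SprungLowerDivisibilityAtThree` (item stmt-BirchSwinnertonDyer-19875), line `chromatic-common-zeros`:
# (R4) with the level-one multiplicity datum as a DIVISIBILITY CERTIFICATE `¬ ξ_3^{t+1} ∣ L♯`
# (`--supports` 19875 `--as helper`; PER PAIR; closes no item)

The per-pair census theorem (R4) `sprungSharpFlatLowerDivisibility_of_levelOneCert_of_analyticRank_le_one`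
(sibling file) asks for `L♯ ≠ 0 ∧ ℓ_{(ξ_3)} Λ/(L♯) ≤ t`. For the x8 census the natural datum is the finite
`3`-adic statement «`ξ_3^{t+1}` does NOT divide `L♯`» (`ξ_3 = T² + 3T + 3`; decided from finitely many
coefficients of `L♯` modulo `(ω_n, 3^k)`), which implies both conjuncts: `L ≠ 0` trivially, and
`ℓ_{(π)} R/(G) ≤ t` for a prime element `π` of a Noetherian domain with `¬ π^{t+1} ∣ G` (§1, the contrapositive
of the tree's `Module.pow_dvd_of_le_lengthAt_quotient`: "`ord_𝔭` is the valuation"). §2 restates (R4) and its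
analytic-rank-zero form with this certificate; §3 derives the certificate from the census's Iwasawa
`λ`-invariant (`λ(L♯) < (p−1)(t+1) ⇒ ξ_p^{t+1} ∤ L♯`, tree `MuLambda.lam`, `lam_mul`, `lam_xi`) and states the
`λ`-form (R4″). CONDITIONAL on the line's S5 five (`h714`, `h3`, `hJ`, `hGZK`,
`hKob`); image-free; BSD / K1 / leaf X8 are NOT proved by anything here.

References: [Sprung2012] Thm. 7.14, Prop. 7.19, Main Conj. 7.21; [GreenbergLNM1716] §5 p. 132;
[Washington1997] §13.2 (valuations at height-one primes of `Λ`).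
-/

set_option linter.dupNamespace false
set_option autoImplicit false

noncomputable section

open scoped Classical NumberField MatrixGroups ModularForm

open NumberField IsDedekindDomain CongruenceSubgroup WeierstrassCurve Field
  Literature.NumberTheory.EllipticCurves Literature.NumberTheory.EllipticCurves.ModularForms
  Literature.NumberTheory.EllipticCurves.ZpExtension Literature.NumberTheory.EllipticCurves.Sprung2017
  Literature.NumberTheory.EllipticCurves.Sprung2012 Literature.NumberTheory.EllipticCurves.Rank1Residual
  Literature.NumberTheory.EllipticCurves.IwasawaAlgebra
  Summit.BirchSwinnertonDyer.BirchSwinnertonDyer.Theorems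
  Summit.BirchSwinnertonDyer.Rank1Residual.Iwasawa Summit.BirchSwinnertonDyer.Rank1Residual.X1.CyclotomicZeros

namespace Summit.BirchSwinnertonDyer.BirchSwinnertonDyer.Theorems.ChromaticCommonZeros

/-! ## §1 `¬ π^{t+1} ∣ G ⇒ ℓ_{(π)} R/(G) ≤ t` -/

section Ord

variable {R : Type*} [CommRing R] [IsDomain R] [IsNoetherianRing R]

/-- **Multiplicity certificate ⇒ length bound**: in a Noetherian domain, for a prime element `π`, the prime
`𝔭 = (π)` and any `G`, if `π^{t+1} ∤ G` then `length_{R_𝔭} (R/(G))_𝔭 ≤ t` (contrapositive of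
`Module.pow_dvd_of_le_lengthAt_quotient`; `G ≠ 0` is automatic). [cite: Washington1997, §13.2] -/
theorem lengthAt_quotient_span_le_of_not_pow_dvd {π G : R} (hπ : Prime π) (𝔭 : PrimeSpectrum R)
    (h𝔭 : 𝔭.asIdeal = Ideal.span {π}) {t : ℕ} (h : ¬ π ^ (t + 1) ∣ G) :
    Module.lengthAt R (R ⧸ Ideal.span {G}) 𝔭 ≤ t := by
  have hG : G ≠ 0 := by rintro rfl; exact h (dvd_zero _)
  by_contra hlt
  refine h (Literature.NumberTheory.EllipticCurves.Module.pow_dvd_of_le_lengthAt_quotient hπ hG 𝔭 h𝔭 ?_)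
  rw [Nat.cast_succ]
  exact (ENat.add_one_le_iff (ENat.coe_ne_top t)).mpr (not_le.mp hlt)

end Ord

/-! ## §2 (R4) with the divisibility certificate -/

/-- **(R4′) Analytic rank `≤ 1`, common zeros only at `(T)` or `(ξ_3)`, `ξ_3^{t+1} ∤ L♯`, and
`LayerRankGEAt W 3 1 (rank E(ℚ) + 2t)` ⟹ K1 for BOTH colours** (per pair, modulo the S5 five). The datum
«`¬ xi 3 ^ (t+1) ∣ L♯`» replaces `L♯ ≠ 0 ∧ ℓ_{(ξ_3)} Λ/(L♯) ≤ t` of (R4) (§1; `ξ_3` is a prime element of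
`Λ`, `isPrime_span_xi`). [cite: Sprung2012, Thm. 7.14 (3) (p. 1504), Prop. 7.19 (p. 1505)]
[cite: GreenbergLNM1716, §5 p. 132] [cite: Washington1997, §13.2] -/
theorem sprungSharpFlatLowerDivisibility_of_levelOneDvdCert_of_analyticRank_le_one
    (h714 : thm714_sharpFlatSelmerDual_finite_torsion) (h3 : realPeriodRat_eq_unit_mul_plusPeriod_three)
    (hJ : thm714seq_sharpFlatColemanKato_zetaJoint) (hGZK : rank_eq_analyticRank_of_analyticRank_le_one)
    (hKob : Kobayashi2013.cor13i_sharpFlat_minOrder_eq_one)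
    (W : WeierstrassCurve ℚ) [W.IsElliptic] [W.IsGloballyMinimal] (p : ℕ) [Fact p.Prime] (hX : ClassX8 W p)
    (hr : W.analyticRank ≤ 1) (t : ℕ)
    (hnc : ∀ {N : ℕ} [NeZero N] (f : CuspForm (Gamma0 N) 2) (ϖ : ℚ) (Lsharp Lflat : IwasawaAlgebra p),
      IsNewformOf W f → (ϖ : ℝ) * W.realPeriodRat = plusPeriod f →
      IsSprungPair f p (W.frobeniusTrace p) Lsharp Lflat →
      ∀ 𝔭 : PrimeSpectrum (IwasawaAlgebra p), 𝔭.asIdeal.height = 1 →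
        (PowerSeries.X : IwasawaAlgebra p) ∉ 𝔭.asIdeal → xi p ∉ 𝔭.asIdeal →
        ∃ (col' : Chroma) (G' : IwasawaAlgebra p),
          iwasawaToPowerSeries p G' =
            PowerSeries.C (ϖ : ℚ_[p]) * iwasawaToPowerSeries p (chromaticL col' Lsharp Lflat) ∧
          G' ∉ 𝔭.asIdeal)
    (hdvd : ∀ {N : ℕ} [NeZero N] (f : CuspForm (Gamma0 N) 2) (ϖ : ℚ) (Lsharp Lflat : IwasawaAlgebra p),
      IsNewformOf W f → (ϖ : ℝ) * W.realPeriodRat = plusPeriod f →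
      IsSprungPair f p (W.frobeniusTrace p) Lsharp Lflat → ¬ xi p ^ (t + 1) ∣ Lsharp)
    (hL : LayerRankGEAt W p 1 (W.mordellWeilRank + (p - 1) * t))
    (col : Chroma) : SprungSharpFlatLowerDivisibility W p col :=
  sprungSharpFlatLowerDivisibility_of_levelOneCert_of_analyticRank_le_one h714 h3 hJ hGZK hKob W p hX hr t hnc
    (fun f ϖ Lsharp Lflat hf hϖ hSP ↦
      ⟨fun h0 ↦ hdvd f ϖ Lsharp Lflat hf hϖ hSP (h0 ▸ dvd_zero _),
        lengthAt_quotient_span_le_of_not_pow_dvd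
          ((Ideal.span_singleton_prime (xi_ne_zero p)).mp (isPrime_span_xi p)) _ rfl
          (hdvd f ϖ Lsharp Lflat hf hϖ hSP)⟩) hL col

/-- **(R4′₀) The analytic-rank-zero form**: `r_an(E) = 0`, common zeros only at `(T)` or `(ξ_3)`,
`ξ_3^{t+1} ∤ L♯`, `LayerRankGEAt W 3 1 (rank E(ℚ) + 2t)` ⟹ K1 for BOTH colours (per pair, modulo the S5 five).
[cite: Sprung2012, Prop. 6.14 (p. 1499), Thm. 7.14 (3) (p. 1504)] [cite: GreenbergLNM1716, §5 p. 132] -/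
theorem sprungSharpFlatLowerDivisibility_of_levelOneDvdCert_of_analyticRank_eq_zero
    (h714 : thm714_sharpFlatSelmerDual_finite_torsion) (h3 : realPeriodRat_eq_unit_mul_plusPeriod_three)
    (hJ : thm714seq_sharpFlatColemanKato_zetaJoint) (hGZK : rank_eq_analyticRank_of_analyticRank_le_one)
    (hKob : Kobayashi2013.cor13i_sharpFlat_minOrder_eq_one)
    (W : WeierstrassCurve ℚ) [W.IsElliptic] [W.IsGloballyMinimal] (p : ℕ) [Fact p.Prime] (hX : ClassX8 W p)
    (hr0 : W.analyticRank = 0) (t : ℕ)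
    (hnc : ∀ {N : ℕ} [NeZero N] (f : CuspForm (Gamma0 N) 2) (ϖ : ℚ) (Lsharp Lflat : IwasawaAlgebra p),
      IsNewformOf W f → (ϖ : ℝ) * W.realPeriodRat = plusPeriod f →
      IsSprungPair f p (W.frobeniusTrace p) Lsharp Lflat →
      ∀ 𝔭 : PrimeSpectrum (IwasawaAlgebra p), 𝔭.asIdeal.height = 1 →
        (PowerSeries.X : IwasawaAlgebra p) ∉ 𝔭.asIdeal → xi p ∉ 𝔭.asIdeal →
        ∃ (col' : Chroma) (G' : IwasawaAlgebra p),
          iwasawaToPowerSeries p G' =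
            PowerSeries.C (ϖ : ℚ_[p]) * iwasawaToPowerSeries p (chromaticL col' Lsharp Lflat) ∧
          G' ∉ 𝔭.asIdeal)
    (hdvd : ∀ {N : ℕ} [NeZero N] (f : CuspForm (Gamma0 N) 2) (ϖ : ℚ) (Lsharp Lflat : IwasawaAlgebra p),
      IsNewformOf W f → (ϖ : ℝ) * W.realPeriodRat = plusPeriod f →
      IsSprungPair f p (W.frobeniusTrace p) Lsharp Lflat → ¬ xi p ^ (t + 1) ∣ Lsharp)
    (hL : LayerRankGEAt W p 1 (W.mordellWeilRank + (p - 1) * t))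
    (col : Chroma) : SprungSharpFlatLowerDivisibility W p col :=
  sprungSharpFlatLowerDivisibility_of_levelOneDvdCert_of_analyticRank_le_one h714 h3 hJ hGZK hKob W p hX
    (by rw [hr0]; exact zero_le_one) t hnc hdvd hL col


/-! ## §3 The certificate from the census `λ`-invariant: `λ(L♯) < (p−1)(t+1) ⇒ ξ_p^{t+1} ∤ L♯` -/

section Lambda

open Summit.BirchSwinnertonDyer.Rank1Residual.X1.MuLambda

variable {p : ℕ} [Fact p.Prime]

/-- **`λ`-certificate ⇒ divisibility certificate**: for `L ≠ 0` in `Λ` with Iwasawa `λ`-invariant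
`λ(L) < (p − 1)(t + 1)`, `ξ_p^{t+1}` does not divide `L` (`λ` is additive and `λ(ξ_p) = p − 1`, tree
`lam_mul`, `lam_pow`, `lam_xi`). At `p = 3`, `t = 1`: `λ(L♯) ≤ 3 ⇒ ξ_3² ∤ L♯` — read off the census's
`(μ, λ)` table. [cite: Washington1997, §7.1 (Weierstrass preparation: λ = degree of the distinguished part)] -/
theorem not_xi_pow_dvd_of_lam_lt {L : IwasawaAlgebra p} (hL : L ≠ 0) {t : ℕ}
    (hlam : lam L < (p - 1) * (t + 1)) : ¬ xi p ^ (t + 1) ∣ L := by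
  rintro ⟨M, rfl⟩
  have hM : M ≠ 0 := fun h ↦ hL (by rw [h, mul_zero])
  have hxi : xi p ^ (t + 1) ≠ 0 := pow_ne_zero _ (xi_ne_zero p)
  rw [lam_mul hxi hM, Summit.BirchSwinnertonDyer.Rank1Residual.X1.ParitySqueeze.lam_pow (xi_ne_zero p),
    lam_xi, mul_comm (p - 1)] at hlam
  omega

end Lambda

/-- **(R4″) The `λ`-form**: analytic rank `≤ 1`, common zeros only at `(T)` or `(ξ_3)`, `L♯ ≠ 0` with
`λ(L♯) < 2(t+1)`, and `LayerRankGEAt W 3 1 (rank E(ℚ) + 2t)` ⟹ K1 for BOTH colours (per pair, modulo the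
S5 five; §3 + (R4′)). With the x8 R5 `(μ, λ)` table this makes the level-one multiplicity datum free for the
cells with `λ♯ ≤ 3` (`t = 1`). [cite: Sprung2012, Thm. 7.14 (3) (p. 1504), Prop. 7.19 (p. 1505)]
[cite: GreenbergLNM1716, §5 p. 132] [cite: Washington1997, §7.1] -/
theorem sprungSharpFlatLowerDivisibility_of_levelOneLamCert_of_analyticRank_le_one
    (h714 : thm714_sharpFlatSelmerDual_finite_torsion) (h3 : realPeriodRat_eq_unit_mul_plusPeriod_three)
    (hJ : thm714seq_sharpFlatColemanKato_zetaJoint) (hGZK : rank_eq_analyticRank_of_analyticRank_le_one)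
    (hKob : Kobayashi2013.cor13i_sharpFlat_minOrder_eq_one)
    (W : WeierstrassCurve ℚ) [W.IsElliptic] [W.IsGloballyMinimal] (p : ℕ) [Fact p.Prime] (hX : ClassX8 W p)
    (hr : W.analyticRank ≤ 1) (t : ℕ)
    (hnc : ∀ {N : ℕ} [NeZero N] (f : CuspForm (Gamma0 N) 2) (ϖ : ℚ) (Lsharp Lflat : IwasawaAlgebra p),
      IsNewformOf W f → (ϖ : ℝ) * W.realPeriodRat = plusPeriod f →
      IsSprungPair f p (W.frobeniusTrace p) Lsharp Lflat →
      ∀ 𝔭 : PrimeSpectrum (IwasawaAlgebra p), 𝔭.asIdeal.height = 1 →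
        (PowerSeries.X : IwasawaAlgebra p) ∉ 𝔭.asIdeal → xi p ∉ 𝔭.asIdeal →
        ∃ (col' : Chroma) (G' : IwasawaAlgebra p),
          iwasawaToPowerSeries p G' =
            PowerSeries.C (ϖ : ℚ_[p]) * iwasawaToPowerSeries p (chromaticL col' Lsharp Lflat) ∧
          G' ∉ 𝔭.asIdeal)
    (hlam : ∀ {N : ℕ} [NeZero N] (f : CuspForm (Gamma0 N) 2) (ϖ : ℚ) (Lsharp Lflat : IwasawaAlgebra p),
      IsNewformOf W f → (ϖ : ℝ) * W.realPeriodRat = plusPeriod f →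
      IsSprungPair f p (W.frobeniusTrace p) Lsharp Lflat →
      Lsharp ≠ 0 ∧ Summit.BirchSwinnertonDyer.Rank1Residual.X1.MuLambda.lam Lsharp < (p - 1) * (t + 1))
    (hL : LayerRankGEAt W p 1 (W.mordellWeilRank + (p - 1) * t))
    (col : Chroma) : SprungSharpFlatLowerDivisibility W p col :=
  sprungSharpFlatLowerDivisibility_of_levelOneDvdCert_of_analyticRank_le_one h714 h3 hJ hGZK hKob W p hX hr t
    hnc (fun f ϖ Lsharp Lflat hf hϖ hSP ↦
      not_xi_pow_dvd_of_lam_lt (hlam f ϖ Lsharp Lflat hf hϖ hSP).1 (hlam f ϖ Lsharp Lflat hf hϖ hSP).2) hL col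

end Summit.BirchSwinnertonDyer.BirchSwinnertonDyer.Theorems.ChromaticCommonZeros

end
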